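import Summits.Parity.GeneralizedHardyLittlewood.Theses.LeeYangFibres
import Summits.Parity.GeneralizedHardyLittlewood.Theorems.LeeYangFibresRelativeDimOneTypeSplit
import Summits.Parity.GeneralizedHardyLittlewood.Theorems.LeeYangFibresRelativeDimOneFloatingDefs
import Summits.Parity.GeneralizedHardyLittlewood.Theorems.LeeYangFibresRelativeDimOneFloatingSiegelRepulsion
import Summits.Parity.GeneralizedHardyLittlewood.Theorems.LeeYangFibresRelativeDimOneFloatingSecondMoment
import Summits.Parity.GeneralizedHardyLittlewood.Theorems.LeeYangFibresRelativeDimOneFloatingTypeClassMoments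
import Summits.Parity.GeneralizedHardyLittlewood.Theorems.LeeYangFibresRelativeDimOneFloatingTypeData
import Summits.Parity.GeneralizedHardyLittlewood.Theorems.LeeYangFibresRelativeDimOneFloatingEndgame
import Summits.Parity.GeneralizedHardyLittlewood.Theorems.LeeYangFibresRelativeDimOneHardness
import Literature.Barriers.Parity.SiegelZeroDichotomyNoSiegelZeros
import HarnessLib

/-!
# Route `LeeYangFibres`, crux `RelativeDimOne` (stmt-Parity-14113), line `floating-level-core` (lead seat a1):
# THE CALIBRATION — the crux IS its parity atom, modulo Matomäki–Merikoski 2023, Theorem 1.3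

All five provable stubs of the checked skeleton `Cruxes/RelativeDimOne/Lines/floating_level_core.lean` are LANDED:
(B) `stub_siegelRepulsion` (`…FloatingSiegelRepulsion.lean`), (A) `stub_flatSecondMoment` (`…FloatingSecondMoment.lean`),
(C1) `stub_typeClassMomentsFlat` (`…FloatingTypeClassMoments.lean`), (C2) `stub_typeDataFlat` (`…FloatingTypeData.lean`),
(C3) `stub_endgameFlat` (`…FloatingEndgame.lean`). This file composes them BY NAME, sorry-free, with the two residual
registered stubs of the line entering as HYPOTHESES — the parity atom P′ = `IncidenceBandlimitedCoreDecay θ`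
(`stub_coreDecay`, OPEN: the crux's own content, NECESSARY by `coreDecay_of_relativeDimOne`) and the theorem in print
`Literature.Barriers.Parity.MatomakiMerikoski2023_pairCorrelation` (`stub_pairCorrelation`, Matomäki–Merikoski, IMRN 2023,
Thm 1.3; a named fact = literature debt, formalisation in progress under `Literature/Barriers/Parity/SiegelZeroPrimePairs*`):

* `relativeDimOne_of_core` — `MM → 0 < θ → θ < 1 → IncidenceBandlimitedCoreDecay θ → RelativeDimOne`
  (P′ ⟹ (B) no Siegel zeros of unbounded quality ⟹ rh.S34 ⟹ (A) L♭ ⟹ (C1) TCM♭ ⟹ (C2) TypeData♭ ⟹ (C3) crux);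
* `relativeDimOne_iff_core` — **`MM → (RelativeDimOne ↔ IncidenceBandlimitedCoreDecay (1/4))`** and
  `relativeDimOne_iff_core_at` for every `0 < θ < 1` (the level and the decay constant of P′ are fake freedoms);
* `noSiegelZeros_of_core` — `MM → 0 < θ → IncidenceBandlimitedCoreDecay θ → NoSiegelZeros`: the bare parity atom
  carries rh.S34 — the constraint exported to every sufficient stub set for 14108 / 14109 / 14113;
* `lowClassSecondMoment_of_core`, `uniformCharPNT_of_core` — modulo MM the parity atom carries the whole
  `L`-content of the crux (the fixed-level `L`-atom at every level `θ₁ ≤ 1`, uniform character PNT).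

So the conjunct `LowClassSecondMoment (1/3)` of the landed type split (quasi-GRH at fixed power level, the death of
line `gallagher-backwards-split`) is struck from the crux's obligations: modulo one theorem in print the residual of
stmt-Parity-14113 is ONE typed statement, P′. Hook: `relativeDimOne_iff_core` (registered helper signature).

References: Green–Tao, Ann. of Math. 171 (2010), Conj. 1.4 [GreenTao2010]; Matomäki–Merikoski, IMRN 2023, Thm 1.3
[MatomakiMerikoski2023]; Gallagher, Invent. Math. 11 (1970), Thm 7 [Gallagher1970].
-/

noncomputable section

open scoped BigOperators Classical
open Literature.NumberTheory.Sieve Literature.Barriers.Parity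
open Literature.NumberTheory.LFunctions (NoSiegelZeros)
open Summit.Parity.GeneralizedHardyLittlewood.Theses.LeeYangFibres (RelativeDimOne)
open Summit.Parity.GeneralizedHardyLittlewood.Cruxes.RelativeDimOne.GallagherBackwards (UniformCharPNT
  uniformCharPNT_of_relativeDimOne)
open Summit.Parity.GeneralizedHardyLittlewood.Cruxes.RelativeDimOne.GallagherBackwardsSplit
open Summit.Parity.GeneralizedHardyLittlewood.Cruxes.RelativeDimOne.TypeSplit

namespace Summit.Parity.GeneralizedHardyLittlewood.Cruxes.RelativeDimOne.FloatingLevelCore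

/-- **The line, composed BY NAME from the five landed stubs**: modulo Matomäki–Merikoski's Theorem 1.3, the parity
atom at any level `0 < θ < 1` implies the crux. P′ ⟹ (`stub_siegelRepulsion`) `¬UnboundedSiegelZeros` ⟹
(`noSiegelZeros_of_not_unboundedSiegelZeros`) rh.S34 ⟹ (`stub_flatSecondMoment`) L♭ ⟹ (`stub_typeClassMomentsFlat`)
TCM♭ ⟹ (`stub_typeDataFlat`, with the landed `stub_singularWeights`, `stub_typeRigidity`) TypeData♭ θ ⟹
(`stub_endgameFlat`) `RelativeDimOne`. [cite: MatomakiMerikoski2023, Theorem 1.3] -/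
theorem relativeDimOne_of_core (hMM : MatomakiMerikoski2023_pairCorrelation) {θ : ℝ} (hθ0 : 0 < θ) (hθ1 : θ < 1)
    (hP : IncidenceBandlimitedCoreDecay θ) : RelativeDimOne := by
  have hU : ¬ UnboundedSiegelZeros := stub_siegelRepulsion hMM θ hθ0 hP
  have hNSZ : NoSiegelZeros := noSiegelZeros_of_not_unboundedSiegelZeros hU
  have hD : TypeDataFlat θ := stub_typeDataFlat θ hθ0 hθ1
    (stub_typeClassMomentsFlat (stub_flatSecondMoment hNSZ)) stub_singularWeights stub_typeRigidity
  exact stub_endgameFlat θ hθ0 hθ1 hP hD stub_typeRigidity stub_singularWeights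

/-- **THE CALIBRATION** (registered helper hook of stmt-Parity-14113): modulo Matomäki–Merikoski 2023, Thm 1.3,
`RelativeDimOne ↔ IncidenceBandlimitedCoreDecay (1/4)` — the crux IS its parity atom (`→`: the landed
`coreDecay_of_relativeDimOne`; `←`: the line). [cite: MatomakiMerikoski2023, Theorem 1.3] -/
theorem relativeDimOne_iff_core :
    Literature.Barriers.Parity.MatomakiMerikoski2023_pairCorrelation →
      (Summit.Parity.GeneralizedHardyLittlewood.Theses.LeeYangFibres.RelativeDimOne ↔
        IncidenceBandlimitedCoreDecay (1 / 4)) :=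
  fun hMM => ⟨coreDecay_of_relativeDimOne (by norm_num),
    fun hP => relativeDimOne_of_core hMM (by norm_num) (by norm_num) hP⟩

/-- The calibration at every level `0 < θ < 1`: all the `IncidenceBandlimitedCoreDecay θ` are equivalent to each
other and to the crux (modulo MM) — the level `θ` and the decay constant of P′ are fake freedoms.
[cite: MatomakiMerikoski2023, Theorem 1.3] -/
theorem relativeDimOne_iff_core_at (hMM : MatomakiMerikoski2023_pairCorrelation) {θ : ℝ} (hθ0 : 0 < θ)
    (hθ1 : θ < 1) : RelativeDimOne ↔ IncidenceBandlimitedCoreDecay θ :=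
  ⟨coreDecay_of_relativeDimOne hθ0, fun hP => relativeDimOne_of_core hMM hθ0 hθ1 hP⟩

/-- **The bare parity atom carries rh.S34** (modulo MM): `IncidenceBandlimitedCoreDecay θ → NoSiegelZeros` for every
`θ > 0` — the constraint every sufficient stub set for P′ (cruxes 14108 / 14109 feed it) must satisfy.
[cite: MatomakiMerikoski2023, Theorem 1.3] -/
theorem noSiegelZeros_of_core (hMM : MatomakiMerikoski2023_pairCorrelation) {θ : ℝ} (hθ0 : 0 < θ)
    (hP : IncidenceBandlimitedCoreDecay θ) : NoSiegelZeros :=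
  noSiegelZeros_of_not_unboundedSiegelZeros (stub_siegelRepulsion hMM θ hθ0 hP)

/-- Modulo MM the parity atom carries the whole `L`-content of the crux: the fixed-level `L`-atom
`LowClassSecondMoment θ₁` at EVERY level `θ₁ ≤ 1` (through the crux and the landed necessity
`lowClassSecondMoment_of_relativeDimOne`). [cite: MatomakiMerikoski2023, Theorem 1.3] -/
theorem lowClassSecondMoment_of_core (hMM : MatomakiMerikoski2023_pairCorrelation) {θ₁ : ℝ} (hθ₁ : θ₁ ≤ 1)
    (hP : IncidenceBandlimitedCoreDecay (1 / 4)) : LowClassSecondMoment θ₁ :=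
  lowClassSecondMoment_of_relativeDimOne hθ₁ ((relativeDimOne_iff_core hMM).mpr hP)

/-- Modulo MM the parity atom implies uniform character PNT to conductor `N^{1−o(1)}` (`uniformCharPNT_of_relativeDimOne`,
landed). [cite: MatomakiMerikoski2023, Theorem 1.3] -/
theorem uniformCharPNT_of_core (hMM : MatomakiMerikoski2023_pairCorrelation)
    (hP : IncidenceBandlimitedCoreDecay (1 / 4)) : UniformCharPNT :=
  uniformCharPNT_of_relativeDimOne ((relativeDimOne_iff_core hMM).mpr hP)

/-- L♭ is NECESSARY for the crux (landed `lowClassSecondMoment_of_relativeDimOne` at level `1`): the conclusion of the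
landed stub (A) asks for nothing the crux does not already imply; and it HOLDS under rh.S34 (`stub_flatSecondMoment`). -/
theorem lowClassSecondMomentFlat_of_relativeDimOne (h : RelativeDimOne) : LowClassSecondMomentFlat :=
  lowClassSecondMomentFlat_of_fixed one_pos (lowClassSecondMoment_of_relativeDimOne le_rfl h)

end Summit.Parity.GeneralizedHardyLittlewood.Cruxes.RelativeDimOne.FloatingLevelCore

end
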